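import Literature.NumberTheory.EllipticCurves.GrossZagierRationalPointPeriodProofs
import Literature.NumberTheory.EllipticCurves.LeadingTermPPartProofs
import Literature.NumberTheory.EllipticCurves.ModularCurveManinConstantProofs
import HarnessLib

/-!
# Road (C) `disegni-pair-two` on crux stmt-BirchSwinnertonDyer-20368 — the newform period ratios `ϖ`, `μ` of the good
# curve `V` from a modular parametrisation datum (inputs of `defectKey_*_modulo_descent`)

Cell `bsd-print-cf2`, width seat `bsd-line-cf2-p1-w8` g23. `--supports stmt-BirchSwinnertonDyer-20368` (helper). THEOREMS
ONLY (no `def`, no named fact, no `sorry`). BSD is not proved by any of this; no summit statement is claimed; 20368 is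
not closed here.

The composition `defectKey_chi8_modulo_descent` (`PrintCf2DisegniPairTwoDefectKeyModuloDescent.lean`) takes the plus period
ratio `ϖ·Ω(V) = Ω⁺_f` (`ϖ ∈ ℚ^×`), and `defectKey_chi4_modulo_descent` / `defectKey_chi8'_modulo_descent` the minus period
ratio `μ·Ω⁻(V) = Ω⁻_f` (`μ ∈ ℚ^×`). Both exist BY NAME for any modular parametrisation datum of `V` (structure
`ModularParametrizationData V N`; its existence at level `N_V` is the catalogued fact `nonempty_modularParametrizationData`):
* `exists_plusPeriodRatio_of_parametrization` — `∃ ϖ ∈ ℚ^×, ϖ·Ω(V) = Ω⁺_f`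
  (`ModularParametrizationData.exists_rat_mul_realPeriodRat_eq_plusPeriod`: `ϖ = m/|c|`);
* `exists_minusPeriodRatio_of_parametrization` — `∃ μ ∈ ℚ^×, μ·Ω⁻(V) = Ω⁻_f`
  (`ModularParametrizationData.exists_int_maninConstant_mul_minusPeriod_eq`: `c·Ω⁻_f = k·Ω⁻(V)`, so `μ = k/c`).
The `2`-adic valuations `v₂(ϖ)`, `v₂(μ)` (Manin constant `c` and the lattice indices `m`, `k`) are the class data left to
the cruxplan (Manin-constant prints for the `cm7` class: `OptimalCurveManinCertificate cm7` in S0″).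

References: B. Edixhoven, Progr. Math. 89 (1991) §1 [EdixhovenManin1991]; J. E. Cremona, Algorithms for Modular
Elliptic Curves (1997) §2.8, §2.10 [CremonaAlgorithms1997].
-/

set_option autoImplicit false
set_option linter.dupNamespace false

noncomputable section

open scoped Classical MatrixGroups ModularForm

open CongruenceSubgroup WeierstrassCurve Literature.NumberTheory.EllipticCurves
  Literature.NumberTheory.EllipticCurves.ModularForms

namespace Summit.BirchSwinnertonDyer.BirchSwinnertonDyer.Theorems.PrintCf2.DisegniPairTwo

/-- **The plus period ratio from a parametrisation datum**: `∃ ϖ ∈ ℚ^×` with `ϖ·Ω(V) = Ω⁺_f` for the newform `f`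
of `V` (`f = D.f` by `q`-expansion uniqueness). [cite: EdixhovenManin1991, §1] -/
theorem exists_plusPeriodRatio_of_parametrization {V : WeierstrassCurve ℚ} [V.IsElliptic] {N : ℕ} [NeZero N]
    (D : ModularParametrizationData V N) {f : CuspForm (Gamma0 N) 2} (hf : IsNewformOf V f) :
    ∃ ϖ : ℚ, ϖ ≠ 0 ∧ (ϖ : ℝ) * V.realPeriodRat = plusPeriod f := by
  have hfD : f = D.f := hf.unique D.isNewformOf
  obtain ⟨ϖ, hϖ, hϖeq, -⟩ := D.exists_rat_mul_realPeriodRat_eq_plusPeriod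
  exact ⟨ϖ, hϖ.ne', hfD ▸ hϖeq⟩

/-- **The minus period ratio from a parametrisation datum**: `∃ μ ∈ ℚ^×` with `μ·Ω⁻(V) = Ω⁻_f`
(`Ω⁻(V) = imaginaryPeriodRat V`, `Ω⁻_f = minusPeriod f`), namely `μ = k/c` from `c·Ω⁻_f = k·Ω⁻(V)` (`c` the Manin
constant, `k ∈ ℤ ∖ 0`). [cite: EdixhovenManin1991, §1] [cite: CremonaAlgorithms1997, §2.8 (p. 26)] -/
theorem exists_minusPeriodRatio_of_parametrization {V : WeierstrassCurve ℚ} [V.IsElliptic] {N : ℕ} [NeZero N]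
    (D : ModularParametrizationData V N) {f : CuspForm (Gamma0 N) 2} (hf : IsNewformOf V f) :
    ∃ μ : ℚ, μ ≠ 0 ∧ (μ : ℝ) * V.imaginaryPeriodRat = minusPeriod f := by
  have hfD : f = D.f := hf.unique D.isNewformOf
  obtain ⟨k, hk, hkeq⟩ := D.exists_int_maninConstant_mul_minusPeriod_eq
  have hc : (D.c : ℚ) ≠ 0 := by exact_mod_cast D.maninConstant_ne_zero_holds
  have hcR : (D.c : ℝ) ≠ 0 := by exact_mod_cast D.maninConstant_ne_zero_holds
  refine ⟨(k : ℚ) / D.c, div_ne_zero (by exact_mod_cast hk) hc, ?_⟩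
  rw [hfD]
  push_cast
  field_simp
  linear_combination -hkeq

end Summit.BirchSwinnertonDyer.BirchSwinnertonDyer.Theorems.PrintCf2.DisegniPairTwo

end
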